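import Summits.QuantumFields.YangMills.Theorems.CurvatureKernelBound.Negative.Moment

/-!
# `CurvatureKernelBound` — negative lemmas VII: the UNCONDITIONAL order-insufficiency witness `T₀ ∘ L₈`

Supports crux item `stmt-QuantumFields-11687` (`PencilRigidity.CurvatureKernelBound`: for every compact simple
`G`, `r`, `sch` and one-species `S₁` carrying the curvature package `W₁`, the two-point function of `S₁` on `⁰𝒮`
is integration against a REAL kernel `K(x₀ − x₁)`, continuous off `0`, with `|K x| ≤ C (1 + ‖x‖^(η−10))`,
`η > 0`). Standing disprover's negative lemmas (refuter, cdisprove); no conclusion below asserts a Theses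
statement positively.

§H'' the massless moment of `L₈` on a bump tensor at `(e₁,0)` is non-zero (`exists_masslessMoment_L8_ne_zero`);
§I the free two-point functional `T0 : F ↦ ∫ G_m(u₀−u₁) F(u) du` IS a continuous linear functional on
`𝓢((ℝ⁴)², ℂ)` (`integrable_G_mul_weight` by Fubini through `finTwoArrow`, seminorm bound `T0const m · semi5`),
`TL8 := T0 ∘ L8`, and **`TL8_not_representable`** (axioms `propext`, `Classical.choice`, `Quot.sound`): the
two-point Schwinger function of the centred Gaussian family with covariance `(Σ_μ k_μ⁸)/(k² + m²)` — translation
invariant, `W(B₄)`-symmetric, reflection positive across the four axis mirrors, exponentially clustering on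
paper — admits NO kernel `K` continuous off `0` with `|K x| ≤ C (1 + ‖x‖^(η−10))`, `η > 0`, representing it on
`⁰𝒮`: any model-blind argument bounding the ORDER of the `tr F²` two-point singularity from the two-point
consequences of `W₁` minus the lattice clause is refuted by it (its kernel `p₈(∂) G_m ∼ 483840/(4π²) · ‖x‖⁻¹⁰`
sits exactly AT the forbidden threshold `η = 0`). [folklore]
-/

open scoped BigOperators Topology SchwartzMap
open MeasureTheory Filter Set
open Literature.MathematicalPhysics.QuantumLattice Literature.MathematicalPhysics.AQFT
  Literature.MathematicalPhysics.QuantumFieldTheory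

noncomputable section

namespace Summit.QuantumFields.YangMills.Theorems.CurvatureKernelBound.Negative

/-! ## §H'' Assembly: the massless moment of `L₈` on a bump tensor at `(e₁,0)` is nonzero -/

section MomentAssembly

open Real
open scoped LineDeriv ContDiff

/-- A continuity radius of `H` at `c`. -/
theorem exists_radius_H8 : ∃ ρ : ℝ, 0 < ρ ∧ ρ ≤ 1 / 8 ∧ ∀ u : Fin 2 → E4, ‖u - basePt‖ < ρ →
    (H8 basePt).re / 2 < (H8 u).re := by
  have hc : ContinuousAt (fun u => H8 u) basePt := H8.continuous.continuousAt
  have hκ := H8_basePt_re_pos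
  obtain ⟨ρ₀, hρ₀, h⟩ := Metric.continuousAt_iff.1 hc ((H8 basePt).re / 2) (half_pos hκ)
  refine ⟨min ρ₀ (1 / 8), lt_min hρ₀ (by norm_num), min_le_right _ _, fun u hu => ?_⟩
  have hd : dist u basePt < ρ₀ := by
    rw [dist_eq_norm]; exact hu.trans_le (min_le_left _ _)
  have h1 := h hd
  rw [dist_eq_norm] at h1
  have hre : |(H8 u).re - (H8 basePt).re| < (H8 basePt).re / 2 := by
    calc |(H8 u).re - (H8 basePt).re| = |(H8 u - H8 basePt).re| := by simp
      _ ≤ ‖H8 u - H8 basePt‖ := Complex.abs_re_le_norm _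
      _ < _ := h1
  rw [abs_sub_lt_iff] at hre
  linarith [hre.1, hre.2]

/-- Products of Schwartz functions are integrable. -/
theorem integrable_schwartz_mul (f g : 𝓢((Fin 2 → E4), ℂ)) :
    Integrable (fun x : Fin 2 → E4 => f x * g x) :=
  g.integrable.bdd_mul f.continuous.aestronglyMeasurable
    (Eventually.of_forall fun x => norm_le_schwartzNorm 0 f x)

/-- **The massless moment of `L₈` does not vanish** (on a bump tensor at `(e₁, 0)`). -/
theorem exists_masslessMoment_L8_ne_zero :
    ∃ F₀ : 𝓢((Fin 2 → E4), ℂ), IsOffDiagonal F₀ ∧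
      (∀ u ∈ tsupport (F₀ : (Fin 2 → E4) → ℂ), (1 / 2 : ℝ) ≤ ‖u 0 - u 1‖ ∧ ‖u 0 - u 1‖ ≤ 2) ∧
      ∫ u, (masslessWeight u : ℂ) * L8 F₀ u ≠ 0 := by
  obtain ⟨ρ, hρ, hρ8, hH⟩ := exists_radius_H8
  set κ : ℝ := (H8 basePt).re with hκdef
  have hκ : 0 < κ := H8_basePt_re_pos
  -- the bumps
  let e₁ : E4 := EuclideanSpace.single 1 1
  let g : ContDiffBump e₁ := ⟨ρ / 4, ρ / 2, by positivity, by linarith⟩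
  let h : ContDiffBump (0 : E4) := ⟨ρ / 4, ρ / 2, by positivity, by linarith⟩
  have hsep0 : g.rOut + h.rOut < ‖e₁ - 0‖ := by
    show ρ / 2 + ρ / 2 < ‖e₁ - 0‖
    rw [sub_zero, norm_single_one_one]; linarith
  let F₀ := bumpTensor g h
  -- support control in the sup norm
  have hsupp : ∀ u, F₀ u ≠ 0 → ‖u - basePt‖ < ρ / 2 := by
    intro u hu
    rw [bumpTensor_apply] at hu
    have hu' : g (u 0) * h (u 1) ≠ 0 := by exact_mod_cast hu
    obtain ⟨hg, hh⟩ := mul_ne_zero_iff.1 hu'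
    have hg' : u 0 ∈ Function.support g := hg
    have hh' : u 1 ∈ Function.support h := hh
    rw [ContDiffBump.support_eq, Metric.mem_ball, dist_eq_norm] at hg' hh'
    rw [pi_norm_lt_iff (by positivity)]
    intro i
    fin_cases i
    · simpa using hg'
    · simpa using hh'
  have htsupp : ∀ u ∈ tsupport (F₀ : (Fin 2 → E4) → ℂ), ‖u - basePt‖ ≤ ρ / 2 := by
    have hS : IsClosed {u : Fin 2 → E4 | ‖u - basePt‖ ≤ ρ / 2} :=
      isClosed_le (continuous_norm.comp (continuous_id.sub continuous_const)) continuous_const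
    have hsub : Function.support (F₀ : (Fin 2 → E4) → ℂ) ⊆ {u | ‖u - basePt‖ ≤ ρ / 2} :=
      fun u hu => (hsupp u hu).le
    exact fun u hu => closure_minimal hsub hS hu
  refine ⟨F₀, isOffDiagonal_bumpTensor g h hsep0, fun u hu => ?_, ?_⟩
  · have hn := htsupp u hu
    have := offDiag_of_near_basePt (ρ := ρ / 2) (by linarith) hn
    constructor <;> linarith [this.2.1, this.2.2]
  -- the moment
  have hΛ : ∀ u, (masslessWeight u : ℂ) * L8 F₀ u = LamS u * L8 F₀ u := by
    intro u
    by_cases hu : L8 F₀ u = 0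
    · simp [hu]
    rw [LamS_eq_of_near ((htsupp u (L8_supp F₀ u hu)).trans (by linarith))]
  have hstep : ∫ u, (masslessWeight u : ℂ) * L8 F₀ u = ∫ u, H8 u * F₀ u := by
    simp_rw [hΛ, L8_apply, sum_apply, Finset.mul_sum]
    rw [integral_finsetSum _ fun μ _ => integrable_schwartz_mul LamS (D8 μ F₀)]
    have hμ : ∀ μ : Fin 4, ∫ u, LamS u * D8 μ F₀ u = ∫ u, D8 μ LamS u * F₀ u := by
      intro μ
      rw [D8_apply, D8_apply, integral_mul_iteratedLineDerivOp_const 8 (V0 μ) LamS F₀]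
      norm_num
    simp_rw [hμ]
    rw [← integral_finsetSum _ fun μ _ => integrable_schwartz_mul (D8 μ LamS) F₀]
    congr 1; funext u
    rw [H8, sum_apply, Finset.sum_mul]
  rw [hstep]
  -- positivity of the real part
  set fR : (Fin 2 → E4) → ℝ := fun u => (H8 u).re * (g (u 0) * h (u 1)) with hfR
  have hint : Integrable (fun u : Fin 2 → E4 => H8 u * F₀ u) := integrable_schwartz_mul H8 F₀
  have hF : ∀ u, F₀ u = ((g (u 0) * h (u 1) : ℝ) : ℂ) := fun u => bumpTensor_apply g h u
  have hre : (∫ u, H8 u * F₀ u).re = ∫ u, fR u := by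
    have h1 := (Complex.reCLM.integral_comp_comm hint).symm
    simp only [Complex.reCLM_apply] at h1
    rw [h1]
    congr 1; funext u
    rw [hF u]
    simp [fR, Complex.mul_re]
  -- lower bound
  set ℓ : (Fin 2 → E4) → ℝ := fun u => κ / 2 * (g (u 0) * h (u 1)) with hℓ
  have hℓ_le : ∀ u, ℓ u ≤ fR u := by
    intro u
    by_cases hgh : g (u 0) * h (u 1) = 0
    · simp [ℓ, fR, hgh]
    have hu : F₀ u ≠ 0 := by
      rw [bumpTensor_apply]; exact_mod_cast hgh
    have hnear : ‖u - basePt‖ < ρ := (hsupp u hu).trans (by linarith)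
    have hHu := hH u hnear
    exact mul_le_mul_of_nonneg_right hHu.le (mul_nonneg g.nonneg h.nonneg)
  have hℓ_cont : Continuous ℓ :=
    continuous_const.mul ((g.continuous.comp (continuous_apply 0)).mul
      (h.continuous.comp (continuous_apply 1)))
  have hℓ_supp : HasCompactSupport ℓ := by
    let B : Fin 2 → Set E4 := ![Metric.closedBall e₁ (ρ / 2), Metric.closedBall (0 : E4) (ρ / 2)]
    refine HasCompactSupport.intro (K := Set.pi Set.univ B)
      (isCompact_univ_pi fun i => ?_) ?_
    · fin_cases i <;> exact isCompact_closedBall _ _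
    · intro x hx
      rw [Set.mem_univ_pi, Fin.forall_fin_two] at hx
      simp only [ℓ]
      have : g (x 0) * h (x 1) = 0 := by
        by_contra hgh
        obtain ⟨hg1, hh1⟩ := mul_ne_zero_iff.1 hgh
        have hg2 : x 0 ∈ Function.support g := hg1
        have hh2 : x 1 ∈ Function.support h := hh1
        rw [ContDiffBump.support_eq] at hg2 hh2
        exact hx ⟨Metric.ball_subset_closedBall hg2, Metric.ball_subset_closedBall hh2⟩
      rw [this, mul_zero]
  have hℓ_nonneg : 0 ≤ ℓ := fun u => by
    simp only [ℓ, Pi.zero_apply]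
    exact mul_nonneg (by positivity) (mul_nonneg g.nonneg h.nonneg)
  have hℓ_c : ℓ basePt ≠ 0 := by
    have hg1 : g (basePt 0) = 1 := g.one_of_mem_closedBall (by
      show basePt 0 ∈ Metric.closedBall e₁ (ρ / 4)
      rw [basePt_zero]; exact Metric.mem_closedBall_self (by positivity))
    have hh1 : h (basePt 1) = 1 := h.one_of_mem_closedBall (by
      show basePt 1 ∈ Metric.closedBall (0 : E4) (ρ / 4)
      rw [basePt_one]; exact Metric.mem_closedBall_self (by positivity))
    simp only [ℓ, hg1, hh1, mul_one]
    positivity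
  have hpos : 0 < ∫ u, ℓ u :=
    hℓ_cont.integral_pos_of_hasCompactSupport_nonneg_nonzero hℓ_supp hℓ_nonneg hℓ_c
  have hintR : Integrable fR := by
    have := hint.re
    refine this.congr (Eventually.of_forall fun u => ?_)
    show (H8 u * F₀ u).re = fR u
    rw [hF u]
    simp [fR, Complex.mul_re]
  have hle : ∫ u, ℓ u ≤ ∫ u, fR u :=
    integral_mono_of_nonneg (Eventually.of_forall hℓ_nonneg) hintR (Eventually.of_forall hℓ_le)
  intro hJ
  have : (∫ u, H8 u * F₀ u).re = 0 := by rw [hJ, Complex.zero_re]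
  rw [hre] at this
  linarith

/-- **Residue R2 discharged.** ANY two-point functional that agrees with
`F ↦ ∫ G_m(u₀-u₁) (L₈F)(u) du` — the two-point function of the §D Gaussian witness — admits NO
kernel with the crux's bound `|K x| ≤ C(1 + ‖x‖^(η-10))`, `η > 0`. (What is still assumed: that
such a `T : TwoPointCLM` exists, i.e. `T₀` is a CLM — residue R1 — and, for the full
`¬ CurvatureKernelBoundWithoutLatticeSixteen`, the package properties of the Gaussian family.) -/
theorem not_representable_T0_L8' {m : ℝ} (hm : 0 < m) (T : TwoPointCLM)
    (hT : ∀ F, T F = ∫ u, (FreeKernel.G m (u 0 - u 1) : ℂ) * L8 F u) :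
    ¬ ∃ (K : E4 → ℝ) (C η : ℝ), KernelData K C η ∧ RepresentsCLM T K := by
  obtain ⟨F₀, hF₀, hsep, hJ⟩ := exists_masslessMoment_L8_ne_zero
  exact not_representable_T0_L8 hm T hT hF₀ (by norm_num : (0 : ℝ) < 1 / 2) hsep hJ

end MomentAssembly

/-! ## §I The free two-point functional `T₀` as a CLM (residue R1) and the UNCONDITIONAL witness -/

section T0

open Real

/-- `u ↦ G_m(u₀-u₁) (1+‖u₁‖)⁻⁵` is integrable on `(ℝ⁴)²` (`‖G_m‖₁ < ∞`, `5 > 4`). -/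
theorem integrable_G_mul_weight {m : ℝ} (hm : m ≠ 0) :
    Integrable (fun u : Fin 2 → E4 => FreeKernel.G m (u 0 - u 1) * (1 + ‖u 1‖) ^ (-(5 : ℝ))) := by
  have hG : Integrable (FreeKernel.G m) := by
    unfold FreeKernel.G
    exact Literature.MathematicalPhysics.QuantumFieldTheory.integrable_freeKernel hm
  set f : E4 × E4 → ℝ := fun p => FreeKernel.G m (p.1 - p.2) * (1 + ‖p.2‖) ^ (-(5 : ℝ)) with hfdef
  have hmeasf : AEStronglyMeasurable f (volume.prod volume) := by
    refine (Measurable.aestronglyMeasurable ?_)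
    have h1 : Measurable fun p : E4 × E4 => FreeKernel.G m (p.1 - p.2) :=
      (FreeKernel.stronglyMeasurable_G m).measurable.comp (measurable_fst.sub measurable_snd)
    have h2 : Measurable fun p : E4 × E4 => (1 + ‖p.2‖) ^ (-(5 : ℝ)) := by fun_prop
    exact h1.mul h2
  have hprod : Integrable f (volume.prod volume) := by
    rw [integrable_prod_iff' hmeasf]
    constructor
    · refine Eventually.of_forall fun y => ?_
      show Integrable (fun x : E4 => FreeKernel.G m (x - y) * (1 + ‖y‖) ^ (-(5 : ℝ)))
      exact (hG.comp_sub_right y).mul_const _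
    · have heq : (fun y : E4 => ∫ x, ‖f (x, y)‖) =
          fun y => (∫ x, FreeKernel.G m x) * (1 + ‖y‖) ^ (-(5 : ℝ)) := by
        funext y
        have hw : 0 ≤ (1 + ‖y‖) ^ (-(5 : ℝ)) := rpow_nonneg (by positivity) _
        have h1 : (fun x => ‖f (x, y)‖) = fun x => FreeKernel.G m (x - y) * (1 + ‖y‖) ^ (-(5 : ℝ)) := by
          funext x
          rw [hfdef]
          simp only [norm_mul, Real.norm_of_nonneg (FreeKernel.G_nonneg m _), Real.norm_of_nonneg hw]
        rw [h1, integral_mul_const, integral_sub_right_eq_self (FreeKernel.G m) y]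
      rw [heq]
      have h5 : (Module.finrank ℝ E4 : ℝ) < 5 := by rw [FreeKernel.finrank_E4]; norm_num
      exact (integrable_one_add_norm h5).const_mul _
  have hmp := MeasureTheory.volume_preserving_finTwoArrow E4
  have hcomp : (fun u : Fin 2 → E4 => FreeKernel.G m (u 0 - u 1) * (1 + ‖u 1‖) ^ (-(5 : ℝ))) =
      f ∘ MeasurableEquiv.finTwoArrow := by
    funext u; rfl
  rw [hcomp]
  exact (hmp.integrable_comp_emb (MeasurableEquiv.finTwoArrow).measurableEmbedding).2 hprod

/-- The `L¹`-type constant of the free two-point functional. -/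
def T0const (m : ℝ) : ℝ :=
  2 ^ 5 * ∫ u : Fin 2 → E4, FreeKernel.G m (u 0 - u 1) * (1 + ‖u 1‖) ^ (-(5 : ℝ))

/-- The constant `T0const m` is non-negative. [folklore] -/
theorem T0const_nonneg (m : ℝ) : 0 ≤ T0const m := by
  unfold T0const
  refine mul_nonneg (by norm_num) (integral_nonneg fun u => ?_)
  exact mul_nonneg (FreeKernel.G_nonneg _ _) (rpow_nonneg (by positivity) _)

/-- The controlling Schwartz seminorm (decay of order `5`, no derivatives). -/
def semi5 : Seminorm ℂ 𝓢((Fin 2 → E4), ℂ) :=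
  (Finset.Iic ((5 : ℕ), (0 : ℕ))).sup (schwartzSeminormFamily ℂ (Fin 2 → E4) ℂ)

/-- Pointwise control of a test function by the seminorm `semi5`. [folklore] -/
theorem norm_le_semi5 (F : 𝓢((Fin 2 → E4), ℂ)) (u : Fin 2 → E4) :
    (1 + ‖u‖) ^ 5 * ‖F u‖ ≤ 2 ^ 5 * semi5 F := by
  have h := SchwartzMap.one_add_le_sup_seminorm_apply (𝕜 := ℂ) (m := ((5 : ℕ), (0 : ℕ)))
    (k := 5) (n := 0) le_rfl le_rfl F u
  rw [norm_iteratedFDeriv_zero] at h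
  exact h

/-- Schwartz decay in the second variable, controlled by `semi5`. -/
theorem norm_schwartz_le_weight (F : 𝓢((Fin 2 → E4), ℂ)) (u : Fin 2 → E4) :
    ‖F u‖ ≤ 2 ^ 5 * semi5 F * (1 + ‖u 1‖) ^ (-(5 : ℝ)) := by
  have h := norm_le_semi5 F u
  have hS0 : 0 ≤ semi5 F := apply_nonneg _ _
  have hpos1 : 0 < 1 + ‖u 1‖ := by positivity
  have hpos : 0 < 1 + ‖u‖ := by positivity
  have hle : 1 + ‖u 1‖ ≤ 1 + ‖u‖ := by linarith [norm_le_pi_norm u 1]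
  have hrpow : (1 + ‖u 1‖) ^ (-(5 : ℝ)) = ((1 + ‖u 1‖) ^ 5)⁻¹ := by
    rw [Real.rpow_neg hpos1.le, show (5 : ℝ) = ((5 : ℕ) : ℝ) by norm_num, Real.rpow_natCast]
  rw [hrpow]
  have h1 : ‖F u‖ ≤ 2 ^ 5 * semi5 F * ((1 + ‖u‖) ^ 5)⁻¹ := by
    rw [← div_eq_mul_inv, le_div_iff₀ (by positivity)]
    linarith [h]
  refine h1.trans (mul_le_mul_of_nonneg_left ?_ (by positivity))
  apply inv_anti₀ (by positivity)
  exact pow_le_pow_left₀ hpos1.le hle 5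

/-- Measurability of the integrand `G_m(u₀−u₁) F(u)`. [folklore] -/
theorem aestronglyMeasurable_G_mul_schwartz (m : ℝ) (F : 𝓢((Fin 2 → E4), ℂ)) :
    AEStronglyMeasurable (fun u : Fin 2 → E4 => (FreeKernel.G m (u 0 - u 1) : ℂ) * F u) volume := by
  have h1 : Measurable fun u : Fin 2 → E4 => u 0 - u 1 := by fun_prop
  exact ((Complex.continuous_ofReal.measurable.comp
    ((FreeKernel.stronglyMeasurable_G m).measurable.comp h1)).aestronglyMeasurable).mul
    F.continuous.aestronglyMeasurable

/-- Pointwise bound of the integrand `G_m(u₀−u₁) F(u)` by the integrable weight. [folklore] -/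
theorem norm_G_mul_schwartz_le (m : ℝ) (F : 𝓢((Fin 2 → E4), ℂ)) (u : Fin 2 → E4) :
    ‖(FreeKernel.G m (u 0 - u 1) : ℂ) * F u‖ ≤
      2 ^ 5 * semi5 F * (FreeKernel.G m (u 0 - u 1) * (1 + ‖u 1‖) ^ (-(5 : ℝ))) := by
  rw [norm_mul, Complex.norm_real, Real.norm_of_nonneg (FreeKernel.G_nonneg _ _)]
  have := mul_le_mul_of_nonneg_left (norm_schwartz_le_weight F u) (FreeKernel.G_nonneg m (u 0 - u 1))
  linarith [this]

/-- Integrability of `u ↦ G_m(u₀-u₁) F(u)`. -/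
theorem integrable_G_mul_schwartz {m : ℝ} (hm : m ≠ 0) (F : 𝓢((Fin 2 → E4), ℂ)) :
    Integrable (fun u : Fin 2 → E4 => (FreeKernel.G m (u 0 - u 1) : ℂ) * F u) :=
  Integrable.mono' ((integrable_G_mul_weight hm).const_mul _) (aestronglyMeasurable_G_mul_schwartz m F)
    (Eventually.of_forall (norm_G_mul_schwartz_le m F))

/-- The seminorm bound of `F ↦ ∫ G_m(u₀-u₁) F(u) du`. -/
theorem norm_integral_G_mul_schwartz_le {m : ℝ} (hm : m ≠ 0) (F : 𝓢((Fin 2 → E4), ℂ)) :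
    ‖∫ u, (FreeKernel.G m (u 0 - u 1) : ℂ) * F u‖ ≤ T0const m * semi5 F := by
  have hmaj : Integrable (fun u : Fin 2 → E4 =>
      2 ^ 5 * semi5 F * (FreeKernel.G m (u 0 - u 1) * (1 + ‖u 1‖) ^ (-(5 : ℝ)))) :=
    (integrable_G_mul_weight hm).const_mul _
  have h1 : ‖∫ u, (FreeKernel.G m (u 0 - u 1) : ℂ) * F u‖ ≤
      ∫ u : Fin 2 → E4, 2 ^ 5 * semi5 F * (FreeKernel.G m (u 0 - u 1) * (1 + ‖u 1‖) ^ (-(5 : ℝ))) :=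
    (norm_integral_le_integral_norm _).trans
      (integral_mono_of_nonneg (Eventually.of_forall fun _ => norm_nonneg _) hmaj
        (Eventually.of_forall (norm_G_mul_schwartz_le m F)))
  rw [integral_const_mul] at h1
  calc ‖∫ u, (FreeKernel.G m (u 0 - u 1) : ℂ) * F u‖
      ≤ 2 ^ 5 * semi5 F *
          ∫ (u : Fin 2 → E4), FreeKernel.G m (u 0 - u 1) * (1 + ‖u 1‖) ^ (-(5 : ℝ)) := h1
    _ = T0const m * semi5 F := by unfold T0const; ring

/-- **The free two-point functional** `T₀ F = ∫ G_m(u₀-u₁) F(u) du` as a continuous linear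
functional on two-point Schwartz space (`m ≠ 0`). -/
def T0 {m : ℝ} (hm : m ≠ 0) : TwoPointCLM :=
  SchwartzMap.mkCLMtoNormedSpace (𝕜 := ℂ) (σ := RingHom.id ℂ)
    (fun F => ∫ u, (FreeKernel.G m (u 0 - u 1) : ℂ) * F u)
    (fun F F' => by
      simp only [add_apply, mul_add]
      exact integral_add (integrable_G_mul_schwartz hm F) (integrable_G_mul_schwartz hm F'))
    (fun a F => by
      simp only [smul_apply, smul_eq_mul, RingHom.id_apply]
      rw [← integral_const_mul]
      congr 1; funext u; ring)
    ⟨Finset.Iic ((5 : ℕ), (0 : ℕ)), T0const m, T0const_nonneg m,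
      fun F => norm_integral_G_mul_schwartz_le hm F⟩

/-- Unfolding `T0`. [folklore] -/
@[simp] theorem T0_apply {m : ℝ} (hm : m ≠ 0) (F : 𝓢((Fin 2 → E4), ℂ)) :
    T0 hm F = ∫ u, (FreeKernel.G m (u 0 - u 1) : ℂ) * F u := rfl

/-- The two-point functional of the §D Gaussian witness `Ĉ(k) = (Σ_μ k_μ⁸)/(k²+m²)` (in the
position-space form `T₀ ∘ L₈`). -/
def TL8 {m : ℝ} (hm : m ≠ 0) : TwoPointCLM := (T0 hm).comp L8

/-- **UNCONDITIONAL (two-point level, residues R1+R2 discharged).** The dressed free two-point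
functional `T₀ ∘ L₈` — i.e. the two-point Schwinger function, on all of `𝓢((ℝ⁴)²)`, of the centred
Gaussian family with covariance `(Σ_μ k_μ⁸)/(k²+m²)` — admits NO kernel `K` continuous off `0`
with `|K x| ≤ C(1 + ‖x‖^(η-10))`, `η > 0`, representing it on `⁰𝒮`. Its package properties
(translations, `W(B₄)`, hermiticity, reflection positivity across the four axis mirrors on
positive-time one-point families, exponential clustering) are residue R3 of
`not_curvatureKernelBound_without_lattice`. -/
theorem TL8_not_representable {m : ℝ} (hm : 0 < m) :
    ¬ ∃ (K : E4 → ℝ) (C η : ℝ), KernelData K C η ∧ RepresentsCLM (TL8 hm.ne') K :=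
  not_representable_T0_L8' hm (TL8 hm.ne') fun _ => rfl

end T0

end Summit.QuantumFields.YangMills.Theorems.CurvatureKernelBound.Negative
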